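import Summits.HodgeConjecture.HodgeConjecture.Theorems.PadicSemiregularLiftFermatAnchorAssemblyGMFDefs

/-!
# Stub `stub_readout` of line `witt-lift-rigid-mf` (crux `FermatAnchorAssembly`, stmt-HodgeConjecture-14874): twisted Euler forms are constant on `L^⊥`-cosets

Route `PadicSemiregularLift` of `HodgeConjecture`, crux `FermatAnchorAssembly`, line `witt-lift-rigid-mf`
(vocabulary `Theorems/PadicSemiregularLiftFermatAnchorAssemblyGMFDefs.lean`; companions
`…StubReadout.lean`, `…StubReadoutAux.lean`). The registered stub `stub_readout` reads `claim(γ)` off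
`Φₘ ∤ Θ_{γ,N}` for a lawful `L`-graded matrix factorization `N` of `Σ_{i<ν} xᵢᵐ`, where
`Θ_{γ,N}(T) = Σ_g χ(N, g^*N) T^{⟨γ,g⟩}` and the grading subgroup `L ≤ (ℤ/m)^ν` is a free parameter. This
file proves, on the constructive carriers of the vocabulary (no hypothesis structure, no named fact), the
isomorphism-invariance input of the analysis of that freedom:

* `diagTwist_add_of_isBihom` — for `h ∈ L^⊥ = {h | Σᵢ hᵢlᵢ = 0 ∀ l ∈ L}` the substitution `xᵢ ↦ ζ^{hᵢ}xᵢ`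
  acts on an `L`-bihomogeneous polynomial of character `c` by the scalar `ζ^{⟨h,c⟩}` (`ζᵐ = 1`); hence
  `(g+h)^*N` is the conjugate of `g^*N` by diagonal scalar matrices (`twist_add_φ`, `twist_add_ψ`);
* `homDim_eq_of_rescale`, `eulerForm_eq_of_rescale` — conjugation by invertible diagonal scalar matrices
  is a linear automorphism of the cochain space mapping closed cochains onto closed cochains and
  null-homotopic ones onto null-homotopic ones (`closedSet_rescale`, `nullSet_rescale`), so `homDim` and
  `eulerForm` are unchanged (`finrank_quotient_comap_eq_of_map`);
* `eulerForm_twist_add_of_perp` — **registered helper sub-goal**: `χ(N, (g+h)^*N) = χ(N, g^*N)` for every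
  lawful `N`, every `g`, every `h ∈ L^⊥` and every `ζ` with `ζᵐ = 1`. Consequence (file `…StubReadoutAux`):
  `Φₘ ∣ Θ_{γ,N}` whenever `γ ∉ L`, so the stub's hypothesis forces `γ ∈ L`.

Sorry-free; axioms ⊆ {propext, Classical.choice, Quot.sound}.
-/

-- `Summit.HodgeConjecture.HodgeConjecture.…` is the tree's mandated summit/problem namespace (single-problem summit).
set_option linter.dupNamespace false

noncomputable section

open Finset

namespace Summit.HodgeConjecture.HodgeConjecture.Cruxes.FermatAnchorAssembly.WittLiftRigidMf

variable {K : Type} [Field K] {ν m : ℕ}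

/-! ### Roots of unity as characters of `ℤ/m` -/

/-- For `ζᵐ = 1`, `a ↦ ζ^{⟨a⟩}` is additive-to-multiplicative on `ℤ/m`. [folklore] -/
theorem pow_val_add [NeZero m] {ζ : K} (hζ : ζ ^ m = 1) (a b : ZMod m) :
    ζ ^ (a + b).val = ζ ^ a.val * ζ ^ b.val := by
  rw [ZMod.val_add, ← pow_eq_pow_mod _ hζ, pow_add]

/-- For `ζᵐ = 1` and `n : ℕ`, `ζ^{⟨n mod m⟩} = ζⁿ`. [folklore] -/
theorem pow_val_natCast [NeZero m] {ζ : K} (hζ : ζ ^ m = 1) (n : ℕ) : ζ ^ (n : ZMod m).val = ζ ^ n := by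
  rw [ZMod.val_natCast, ← pow_eq_pow_mod _ hζ]

/-- `ζᵐ = 1` with `m ≥ 1` forces `ζ ≠ 0`. [folklore] -/
theorem ne_zero_of_pow_eq_one [NeZero m] {ζ : K} (hζ : ζ ^ m = 1) : ζ ≠ 0 := by
  rintro rfl
  rw [zero_pow (NeZero.ne m)] at hζ
  exact zero_ne_one hζ

/-! ### The diagonal substitution on bihomogeneous polynomials -/

/-- `xᵢ ↦ ζ^{⟨gᵢ⟩} xᵢ` multiplies the monomial `a·x^e` by `ζ^{Σ ⟨gᵢ⟩ eᵢ}`. [folklore] -/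
theorem diagTwist_monomial (ζ : K) (g : Fin ν → ZMod m) (e : Fin ν →₀ ℕ) (a : K) :
    GMFData.diagTwist ζ g (MvPolynomial.monomial e a) =
      MvPolynomial.monomial e (a * ζ ^ (∑ i ∈ e.support, (g i).val * e i)) := by
  change MvPolynomial.aeval _ (MvPolynomial.monomial e a) = _
  rw [MvPolynomial.aeval_monomial, MvPolynomial.algebraMap_eq]
  have : (e.prod fun i k ↦ (MvPolynomial.C (ζ ^ (g i).val) * MvPolynomial.X i : MvPolynomial (Fin ν) K) ^ k)
      = MvPolynomial.C (ζ ^ (∑ i ∈ e.support, (g i).val * e i)) * e.prod fun i k ↦ MvPolynomial.X i ^ k := by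
    simp only [Finsupp.prod, mul_pow, Finset.prod_mul_distrib, ← map_pow, ← map_prod, ← pow_mul,
      Finset.prod_pow_eq_pow_sum]
  rw [this, ← mul_assoc, ← map_mul, ← MvPolynomial.monomial_eq]

/-- **`L^⊥`-equivariance of the diagonal substitution**: if every monomial of `q` has character
`≡ c (mod L)` and `h` pairs to zero with `L`, then substituting `ζ^{g+h}` is substituting `ζ^{g}` followed
by the scalar `ζ^{⟨h, c⟩}` (`ζᵐ = 1`). [folklore] -/
theorem diagTwist_add_of_isBihom [NeZero m] {ζ : K} (hζ : ζ ^ m = 1) {L : AddSubgroup (Fin ν → ZMod m)}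
    {q : MvPolynomial (Fin ν) K} {d : ℤ} {c : Fin ν → ZMod m} (hq : IsBihom m L q d c)
    (g : Fin ν → ZMod m) {h : Fin ν → ZMod m} (hh : ∀ l ∈ L, ∑ i, h i * l i = 0) :
    GMFData.diagTwist ζ (g + h) q = MvPolynomial.C (ζ ^ (∑ i, h i * c i).val) * GMFData.diagTwist ζ g q := by
  conv_lhs => rw [q.as_sum]
  conv_rhs => rw [q.as_sum]
  rw [map_sum, map_sum, Finset.mul_sum]
  refine Finset.sum_congr rfl fun e he ↦ ?_
  rw [diagTwist_monomial, diagTwist_monomial, MvPolynomial.C_mul_monomial]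
  congr 1
  -- the character of `x^e` seen by `h` is `⟨h, c⟩`
  have hc : ∑ i ∈ e.support, h i * (e i : ZMod m) = ∑ i, h i * c i := by
    have h0 := hh _ (hq e he).2
    rw [Finset.sum_subset (Finset.subset_univ e.support) (fun i _ hi ↦ by
      rw [Finsupp.notMem_support_iff.mp hi, Nat.cast_zero, mul_zero])]
    simpa [gdeg, mul_sub, Finset.sum_sub_distrib, sub_eq_zero] using h0
  have key : ζ ^ (∑ i ∈ e.support, ((g + h) i).val * e i) =
      ζ ^ (∑ i, h i * c i).val * ζ ^ (∑ i ∈ e.support, (g i).val * e i) := by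
    rw [← pow_val_natCast hζ, ← pow_val_natCast hζ (∑ i ∈ e.support, (g i).val * e i), ← pow_val_add hζ]
    congr 2
    push_cast
    simp only [ZMod.natCast_val, ZMod.cast_id', id_eq, Pi.add_apply, add_mul, Finset.sum_add_distrib, ← hc]
    ring
  rw [key]
  ring

/-- With the character written as a difference `c₁ - c₀`, the scalar splits as `(ζ^{⟨h,c₀⟩})⁻¹ · ζ^{⟨h,c₁⟩}`
— the shape of a conjugation by diagonal matrices. [folklore] -/
theorem diagTwist_add_of_isBihom_sub [NeZero m] {ζ : K} (hζ : ζ ^ m = 1) {L : AddSubgroup (Fin ν → ZMod m)}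
    {q : MvPolynomial (Fin ν) K} {d : ℤ} {c₀ c₁ : Fin ν → ZMod m} (hq : IsBihom m L q d (c₁ - c₀))
    (g : Fin ν → ZMod m) {h : Fin ν → ZMod m} (hh : ∀ l ∈ L, ∑ i, h i * l i = 0) :
    GMFData.diagTwist ζ (g + h) q = MvPolynomial.C (ζ ^ (∑ i, h i * c₀ i).val)⁻¹ *
      GMFData.diagTwist ζ g q * MvPolynomial.C (ζ ^ (∑ i, h i * c₁ i).val) := by
  rw [diagTwist_add_of_isBihom hζ hq g hh]
  have key : ζ ^ (∑ i, h i * (c₁ - c₀) i).val =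
      (ζ ^ (∑ i, h i * c₀ i).val)⁻¹ * ζ ^ (∑ i, h i * c₁ i).val := by
    rw [eq_inv_mul_iff_mul_eq₀ (pow_ne_zero _ (ne_zero_of_pow_eq_one hζ)), ← pow_val_add hζ]
    congr 2
    simp only [Pi.sub_apply, mul_sub, Finset.sum_sub_distrib, add_sub_cancel]
  rw [key, map_mul]
  ring

/-- Bihomogeneity is stable under constant factors. [folklore] -/
theorem IsBihom.C_mul {L : AddSubgroup (Fin ν → ZMod m)} {q : MvPolynomial (Fin ν) K} {d : ℤ}
    {c : Fin ν → ZMod m} (hq : IsBihom m L q d c) (a : K) : IsBihom m L (MvPolynomial.C a * q) d c := by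
  intro e he
  rw [MvPolynomial.C_mul'] at he
  exact hq e (MvPolynomial.support_smul he)

/-! ### Lawful factorizations: `(g+h)^*N` is a diagonal conjugate of `g^*N` for `h ∈ L^⊥` -/

section Lawful

variable [NeZero m] {L : AddSubgroup (Fin ν → ZMod m)} {ι₀ ι₁ : Type} [Fintype ι₀] [Fintype ι₁]
  [DecidableEq ι₀] [DecidableEq ι₁]

/-- For a lawful `N` and `h ∈ L^⊥`: `φ_{(g+h)^*N} = D₀⁻¹ φ_{g^*N} D₁` with the diagonal scalar matrices
`D₀ = diag(ζ^{⟨h, c₀ k⟩})`, `D₁ = diag(ζ^{⟨h, c₁ j⟩})`. [folklore] -/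
theorem twist_add_φ (N : GMF K ν m L ι₀ ι₁) {ζ : K} (hζ : ζ ^ m = 1) (g : Fin ν → ZMod m)
    {h : Fin ν → ZMod m} (hh : ∀ l ∈ L, ∑ i, h i * l i = 0) :
    (N.toGMFData.twist ζ (g + h)).φ =
      Matrix.diagonal (fun k ↦ MvPolynomial.C (ζ ^ (∑ i, h i * N.c₀ k i).val)⁻¹) *
        (N.toGMFData.twist ζ g).φ * Matrix.diagonal (fun j ↦ MvPolynomial.C (ζ ^ (∑ i, h i * N.c₁ j i).val)) := by
  refine Matrix.ext fun k j ↦ ?_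
  simp only [GMFData.twist, Matrix.map_apply, Matrix.mul_diagonal, Matrix.diagonal_mul]
  exact diagTwist_add_of_isBihom_sub hζ (N.φ_bihom k j) g hh

/-- Likewise `ψ_{(g+h)^*N} = D₁⁻¹ ψ_{g^*N} D₀`. [folklore] -/
theorem twist_add_ψ (N : GMF K ν m L ι₀ ι₁) {ζ : K} (hζ : ζ ^ m = 1) (g : Fin ν → ZMod m)
    {h : Fin ν → ZMod m} (hh : ∀ l ∈ L, ∑ i, h i * l i = 0) :
    (N.toGMFData.twist ζ (g + h)).ψ =
      Matrix.diagonal (fun j ↦ MvPolynomial.C (ζ ^ (∑ i, h i * N.c₁ j i).val)⁻¹) *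
        (N.toGMFData.twist ζ g).ψ * Matrix.diagonal (fun k ↦ MvPolynomial.C (ζ ^ (∑ i, h i * N.c₀ k i).val)) := by
  refine Matrix.ext fun j k ↦ ?_
  simp only [GMFData.twist, Matrix.map_apply, Matrix.mul_diagonal, Matrix.diagonal_mul]
  exact diagTwist_add_of_isBihom_sub hζ (N.ψ_bihom j k) g hh

end Lawful

/-! ### Diagonal rescalings do not change `homDim` and `eulerForm` -/

section Rescale

variable {L : AddSubgroup (Fin ν → ZMod m)} {ι₀ ι₁ κ₀ κ₁ : Type} [Fintype ι₀] [Fintype ι₁] [Fintype κ₀]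
  [Fintype κ₁] [DecidableEq κ₀] [DecidableEq κ₁]

/-- `diag(C v) · diag(C u) = 1` when `v u = 1` pointwise. [folklore] -/
theorem diagonal_C_mul_diagonal_C {κ : Type} [Fintype κ] [DecidableEq κ] {u v : κ → K}
    (h : ∀ k, v k * u k = 1) :
    Matrix.diagonal (fun k ↦ (MvPolynomial.C (v k) : MvPolynomial (Fin ν) K)) *
      Matrix.diagonal (fun k ↦ MvPolynomial.C (u k)) = 1 := by
  rw [Matrix.diagonal_mul_diagonal, ← Matrix.diagonal_one]
  congr 1
  funext k
  rw [← map_mul, h, map_one]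

section Transport

variable {t : ℤ} {M : GMFData K ν m ι₀ ι₁} {P Q : GMFData K ν m κ₀ κ₁} {u₀ v₀ : κ₀ → K} {u₁ v₁ : κ₁ → K}
  (hv₀ : ∀ k, v₀ k * u₀ k = 1) (hv₁ : ∀ l, v₁ l * u₁ l = 1)
  (h₀ : Q.d₀ = P.d₀) (h₁ : Q.d₁ = P.d₁) (hc₀ : Q.c₀ = P.c₀) (hc₁ : Q.c₁ = P.c₁)
  (hφ : Q.φ = Matrix.diagonal (fun k ↦ MvPolynomial.C (u₀ k)) * P.φ *
    Matrix.diagonal (fun l ↦ MvPolynomial.C (v₁ l)))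
  (hψ : Q.ψ = Matrix.diagonal (fun l ↦ MvPolynomial.C (u₁ l)) * P.ψ *
    Matrix.diagonal (fun k ↦ MvPolynomial.C (v₀ k)))
  {ab : Matrix κ₀ ι₀ (MvPolynomial (Fin ν) K) × Matrix κ₁ ι₁ (MvPolynomial (Fin ν) K)}

include hv₀ hv₁ h₀ h₁ hc₀ hc₁ hφ hψ

/-- A diagonal rescaling `(a, b) ↦ (D(u₀) a, D(u₁) b)` carries closed cochains `M → P(t)` to closed
cochains `M → Q(t)` when `φ_Q = D(u₀) φ_P D(v₁)`, `ψ_Q = D(u₁) ψ_P D(v₀)`, `v u = 1`. [folklore] -/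
theorem closedSet_rescale (hab : ab ∈ GMFData.closedSet m L t M P) :
    (Matrix.diagonal (fun k ↦ MvPolynomial.C (u₀ k)) * ab.1,
      Matrix.diagonal (fun l ↦ MvPolynomial.C (u₁ l)) * ab.2) ∈ GMFData.closedSet m L t M Q := by
  have hD₀ := diagonal_C_mul_diagonal_C (ν := ν) hv₀
  have hD₁ := diagonal_C_mul_diagonal_C (ν := ν) hv₁
  obtain ⟨⟨hco₀, hco₁⟩, h1, h2⟩ := hab
  refine ⟨⟨fun k i ↦ ?_, fun l j ↦ ?_⟩, ?_, ?_⟩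
  · dsimp only
    rw [Matrix.diagonal_mul, h₀, hc₀]
    exact (hco₀ k i).C_mul _
  · dsimp only
    rw [Matrix.diagonal_mul, h₁, hc₁]
    exact (hco₁ l j).C_mul _
  · dsimp only
    rw [hφ]
    simp only [Matrix.mul_assoc]
    rw [← Matrix.mul_assoc (Matrix.diagonal fun l ↦ MvPolynomial.C (v₁ l)), hD₁, Matrix.one_mul, h1]
  · dsimp only
    rw [hψ]
    simp only [Matrix.mul_assoc]
    rw [← Matrix.mul_assoc (Matrix.diagonal fun k ↦ MvPolynomial.C (v₀ k)), hD₀, Matrix.one_mul, h2]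

/-- The same rescaling carries null-homotopic cochains to null-homotopic cochains. [folklore] -/
theorem nullSet_rescale (hab : ab ∈ GMFData.nullSet m L t M P) :
    (Matrix.diagonal (fun k ↦ MvPolynomial.C (u₀ k)) * ab.1,
      Matrix.diagonal (fun l ↦ MvPolynomial.C (u₁ l)) * ab.2) ∈ GMFData.nullSet m L t M Q := by
  have hD₀ := diagonal_C_mul_diagonal_C (ν := ν) hv₀
  have hD₁ := diagonal_C_mul_diagonal_C (ν := ν) hv₁
  obtain ⟨s, u, hs, hu, h1, h2⟩ := hab
  refine ⟨Matrix.diagonal (fun l ↦ MvPolynomial.C (u₁ l)) * s,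
    Matrix.diagonal (fun k ↦ MvPolynomial.C (u₀ k)) * u, fun l i ↦ ?_, fun k j ↦ ?_, ?_, ?_⟩
  · rw [Matrix.diagonal_mul, h₁, hc₁]
    exact (hs l i).C_mul _
  · rw [Matrix.diagonal_mul, h₀, hc₀]
    exact (hu k j).C_mul _
  · dsimp only
    rw [h1, hφ, Matrix.mul_add]
    simp only [Matrix.mul_assoc]
    rw [← Matrix.mul_assoc (Matrix.diagonal fun l ↦ MvPolynomial.C (v₁ l)), hD₁, Matrix.one_mul]
  · dsimp only
    rw [h2, hψ, Matrix.mul_add]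
    simp only [Matrix.mul_assoc]
    rw [← Matrix.mul_assoc (Matrix.diagonal fun k ↦ MvPolynomial.C (v₀ k)), hD₀, Matrix.one_mul]

end Transport

/-- Linear algebra: a linear automorphism `e` carrying `S` onto `S'` and `T` onto `T'` identifies
`S/(S ∩ T)` with `S'/(S' ∩ T')`, so the `finrank`s agree. [folklore] -/
theorem finrank_quotient_comap_eq_of_map {V : Type*} [AddCommGroup V] [Module K V] (e : V ≃ₗ[K] V)
    {S S' T T' : Submodule K V} (hS : S.map (e : V →ₗ[K] V) = S') (hT : T.map (e : V →ₗ[K] V) = T') :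
    Module.finrank K (↥S' ⧸ Submodule.comap S'.subtype T') =
      Module.finrank K (↥S ⧸ Submodule.comap S.subtype T) := by
  subst hS hT
  refine (Submodule.Quotient.equiv (Submodule.comap S.subtype T)
    (Submodule.comap (S.map (e : V →ₗ[K] V)).subtype (T.map (e : V →ₗ[K] V)))
    (e.submoduleMap S) ?_).finrank_eq.symm
  ext ⟨y, hy⟩
  simp only [Submodule.mem_map, Submodule.mem_comap, Submodule.subtype_apply]
  constructor
  · rintro ⟨x, hx, hxy⟩
    exact ⟨(x : V), hx, by simpa using congrArg Subtype.val hxy⟩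
  · rintro ⟨v, hv, hvy⟩
    obtain ⟨s, hs, hsy⟩ := Submodule.mem_map.mp hy
    have hvs : v = s := e.injective (hvy.trans hsy.symm)
    refine ⟨⟨v, hvs ▸ hs⟩, hv, Subtype.ext ?_⟩
    simpa using hvy

section Iso

variable (L : AddSubgroup (Fin ν → ZMod m)) (M : GMFData K ν m ι₀ ι₁) (P Q : GMFData K ν m κ₀ κ₁)
  (d₀ : κ₀ → K) (d₁ : κ₁ → K) (hd₀ : ∀ k, d₀ k ≠ 0) (hd₁ : ∀ l, d₁ l ≠ 0)
  (h₀ : Q.d₀ = P.d₀) (h₁ : Q.d₁ = P.d₁) (hc₀ : Q.c₀ = P.c₀) (hc₁ : Q.c₁ = P.c₁)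
  (hφ : Q.φ = Matrix.diagonal (fun k ↦ MvPolynomial.C (d₀ k)⁻¹) * P.φ *
    Matrix.diagonal (fun l ↦ MvPolynomial.C (d₁ l)))
  (hψ : Q.ψ = Matrix.diagonal (fun l ↦ MvPolynomial.C (d₁ l)⁻¹) * P.ψ *
    Matrix.diagonal (fun k ↦ MvPolynomial.C (d₀ k)))

include hd₀ hd₁ h₀ h₁ hc₀ hc₁ hφ hψ

/-- **`homDim` is invariant under diagonal rescaling of the target**: if `Q` has the labels of `P` and
`φ_Q = D₀⁻¹ φ_P D₁`, `ψ_Q = D₁⁻¹ ψ_P D₀` for diagonal scalar matrices `D₀ = diag(C d₀)`, `D₁ = diag(C d₁)`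
with non-zero entries (an isomorphism `P ≅ Q` of twist `0`), then `dim Hom(M, Q(t)) = dim Hom(M, P(t))`:
the rescaling is a linear automorphism of the cochain space mapping closed onto closed and null onto null
cochains. [folklore] -/
theorem homDim_eq_of_rescale (t : ℤ) : GMFData.homDim K L t M Q = GMFData.homDim K L t M P := by
  have hDE₀ := diagonal_C_mul_diagonal_C (ν := ν) (fun k ↦ mul_inv_cancel₀ (hd₀ k))
  have hED₀ := diagonal_C_mul_diagonal_C (ν := ν) (fun k ↦ inv_mul_cancel₀ (hd₀ k))
  have hDE₁ := diagonal_C_mul_diagonal_C (ν := ν) (fun l ↦ mul_inv_cancel₀ (hd₁ l))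
  have hED₁ := diagonal_C_mul_diagonal_C (ν := ν) (fun l ↦ inv_mul_cancel₀ (hd₁ l))
  -- the inverse relations
  have hφ' : P.φ = Matrix.diagonal (fun k ↦ MvPolynomial.C (d₀ k)) * Q.φ *
      Matrix.diagonal (fun l ↦ MvPolynomial.C (d₁ l)⁻¹) := by
    rw [hφ]
    simp only [Matrix.mul_assoc]
    rw [hDE₁, Matrix.mul_one, ← Matrix.mul_assoc, hDE₀, Matrix.one_mul]
  have hψ' : P.ψ = Matrix.diagonal (fun l ↦ MvPolynomial.C (d₁ l)) * Q.ψ *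
      Matrix.diagonal (fun k ↦ MvPolynomial.C (d₀ k)⁻¹) := by
    rw [hψ]
    simp only [Matrix.mul_assoc]
    rw [hDE₀, Matrix.mul_one, ← Matrix.mul_assoc, hDE₁, Matrix.one_mul]
  -- the rescaling automorphism of the cochain space
  let e : (Matrix κ₀ ι₀ (MvPolynomial (Fin ν) K) × Matrix κ₁ ι₁ (MvPolynomial (Fin ν) K)) ≃ₗ[K]
      (Matrix κ₀ ι₀ (MvPolynomial (Fin ν) K) × Matrix κ₁ ι₁ (MvPolynomial (Fin ν) K)) :=
    { toFun := fun ab ↦ (Matrix.diagonal (fun k ↦ MvPolynomial.C (d₀ k)⁻¹) * ab.1,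
        Matrix.diagonal (fun l ↦ MvPolynomial.C (d₁ l)⁻¹) * ab.2)
      map_add' := fun x y ↦ by
        simp only [Prod.fst_add, Prod.snd_add, Matrix.mul_add, Prod.mk_add_mk]
      map_smul' := fun a x ↦ by
        simp only [Prod.smul_fst, Prod.smul_snd, Matrix.mul_smul, RingHom.id_apply, Prod.smul_mk]
      invFun := fun ab ↦ (Matrix.diagonal (fun k ↦ MvPolynomial.C (d₀ k)) * ab.1,
        Matrix.diagonal (fun l ↦ MvPolynomial.C (d₁ l)) * ab.2)
      left_inv := fun x ↦ by simp only [← Matrix.mul_assoc, hDE₀, hDE₁, Matrix.one_mul, Prod.mk.eta]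
      right_inv := fun x ↦ by simp only [← Matrix.mul_assoc, hED₀, hED₁, Matrix.one_mul, Prod.mk.eta] }
  have hinv₀ : ∀ k, d₀ k * (d₀ k)⁻¹ = 1 := fun k ↦ mul_inv_cancel₀ (hd₀ k)
  have hinv₁ : ∀ l, d₁ l * (d₁ l)⁻¹ = 1 := fun l ↦ mul_inv_cancel₀ (hd₁ l)
  have hinv₀' : ∀ k, (d₀ k)⁻¹ * d₀ k = 1 := fun k ↦ inv_mul_cancel₀ (hd₀ k)
  have hinv₁' : ∀ l, (d₁ l)⁻¹ * d₁ l = 1 := fun l ↦ inv_mul_cancel₀ (hd₁ l)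
  have hC : (Submodule.span K (GMFData.closedSet m L t M P)).map
      (e : _ →ₗ[K] _) = Submodule.span K (GMFData.closedSet m L t M Q) := by
    rw [Submodule.map_span]
    congr 1
    refine Set.Subset.antisymm ?_ fun y hy ↦ ⟨e.symm y, ?_, e.apply_symm_apply y⟩
    · rintro _ ⟨x, hx, rfl⟩
      exact closedSet_rescale hinv₀ hinv₁ h₀ h₁ hc₀ hc₁ hφ hψ hx
    · exact closedSet_rescale hinv₀' hinv₁' h₀.symm h₁.symm hc₀.symm hc₁.symm hφ' hψ' hy
  have hN : (Submodule.span K (GMFData.nullSet m L t M P)).map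
      (e : _ →ₗ[K] _) = Submodule.span K (GMFData.nullSet m L t M Q) := by
    rw [Submodule.map_span]
    congr 1
    refine Set.Subset.antisymm ?_ fun y hy ↦ ⟨e.symm y, ?_, e.apply_symm_apply y⟩
    · rintro _ ⟨x, hx, rfl⟩
      exact nullSet_rescale hinv₀ hinv₁ h₀ h₁ hc₀ hc₁ hφ hψ hx
    · exact nullSet_rescale hinv₀' hinv₁' h₀.symm h₁.symm hc₀.symm hc₁.symm hφ' hψ' hy
  unfold GMFData.homDim
  exact finrank_quotient_comap_eq_of_map e hC hN

/-- **The Euler form is invariant under diagonal rescaling of the target** (all twists; the shift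
`[1]` swaps the roles of `D₀`, `D₁`). [folklore] -/
theorem eulerForm_eq_of_rescale : GMFData.eulerForm K L M Q = GMFData.eulerForm K L M P := by
  unfold GMFData.eulerForm
  refine finsum_congr fun j ↦ ?_
  have hs₀ : Q.shift.d₀ = P.shift.d₀ := by
    show (fun l ↦ Q.d₁ l - (m : ℤ)) = fun l ↦ P.d₁ l - (m : ℤ)
    rw [h₁]
  rw [homDim_eq_of_rescale L M P Q d₀ d₁ hd₀ hd₁ h₀ h₁ hc₀ hc₁ hφ hψ,
    homDim_eq_of_rescale L M P.shift Q.shift d₁ d₀ hd₁ hd₀ hs₀ h₀ hc₁ hc₀ hψ hφ]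

end Iso

end Rescale

/-! ### Twisted Euler forms are constant on `L^⊥`-cosets -/

section Perp

variable [NeZero m] {L : AddSubgroup (Fin ν → ZMod m)} {ι₀ ι₁ : Type} [Fintype ι₀] [Fintype ι₁]
  [DecidableEq ι₀] [DecidableEq ι₁]

/-- **`χ(N, (g+h)^*N) = χ(N, g^*N)` for `h ∈ L^⊥`**: the twisted Euler forms of a lawful `L`-graded
factorization are constant on the cosets of `L^⊥ = {h | ⟨h, L⟩ = 0}`. [folklore] -/
theorem eulerForm_twist_add (N : GMF K ν m L ι₀ ι₁) {ζ : K} (hζ : ζ ^ m = 1) (g : Fin ν → ZMod m)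
    {h : Fin ν → ZMod m} (hh : ∀ l ∈ L, ∑ i, h i * l i = 0) :
    GMFData.eulerForm K L N.toGMFData (N.toGMFData.twist ζ (g + h)) =
      GMFData.eulerForm K L N.toGMFData (N.toGMFData.twist ζ g) :=
  have hz := ne_zero_of_pow_eq_one hζ
  eulerForm_eq_of_rescale L N.toGMFData (N.toGMFData.twist ζ g) (N.toGMFData.twist ζ (g + h))
    (fun k ↦ ζ ^ (∑ i, h i * N.c₀ k i).val) (fun l ↦ ζ ^ (∑ i, h i * N.c₁ l i).val)
    (fun _ ↦ pow_ne_zero _ hz) (fun _ ↦ pow_ne_zero _ hz) rfl rfl rfl rfl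
    (twist_add_φ N hζ g hh) (twist_add_ψ N hζ g hh)

/-- **Registered helper sub-goal `eulerForm_twist_add_of_perp` (for `stub_readout`): the twisted Euler
forms `χ(N, g^*N)` of a lawful `L`-graded factorization of `Σ xᵢᵐ` are constant on the cosets of `L^⊥`**
(over any field, for any `ζ` with `ζᵐ = 1`). [folklore] -/
theorem eulerForm_twist_add_of_perp : ∀ (ν m : ℕ) [NeZero m] (K : Type) [Field K] (ζ : K), ζ ^ m = 1 → ∀ (ι₀ ι₁ : Type) [Fintype ι₀] [Fintype ι₁] [DecidableEq ι₀] [DecidableEq ι₁] (L : AddSubgroup (Fin ν → ZMod m)) (N : GMF K ν m L ι₀ ι₁) (g h : Fin ν → ZMod m), (∀ l ∈ L, ∑ i, h i * l i = 0) → GMFData.eulerForm K L N.toGMFData (N.toGMFData.twist ζ (g + h)) = GMFData.eulerForm K L N.toGMFData (N.toGMFData.twist ζ g) := by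
  intro ν m _ K _ ζ hζ ι₀ ι₁ _ _ _ _ L N g h hh
  exact eulerForm_twist_add N hζ g hh

end Perp

end Summit.HodgeConjecture.HodgeConjecture.Cruxes.FermatAnchorAssembly.WittLiftRigidMf

end
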